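import Mathlib.Data.Real.Basic
import Mathlib.Tactic.Linarith
import Mathlib.Tactic.Ring
import Mathlib.Tactic.Positivity
import Mathlib.Tactic.FieldSimp
import HarnessLib

/-!
# Edge interpolation for reverse-Harris rows of the form `N ≥ κ·F·E` (algebraic core of an induction on edges)

Support file for the Sahi programme (`--supports stmt-CriticalPhenomena-4575`, prover prim-nh-lead-4575 lead gen 126).
No definitions, no named facts, no sorries; standard axioms; pure real arithmetic.

SETTING (paper level).  For a finite weighted graph and one pair `e` of weight `r ∈ [0,1]`, every probability is AFFINE in
`r`: `X(r) = (1-r)·X₀ + r·X₁`, where `X₀` is the value for `G ∖ e` (pair absent) and `X₁` the value for `G / e` (pair sure,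
i.e. endpoints identified).  A row of the shape

  `N ≥ κ · F · E`        (e.g. TCB'_κ : `P(F₁ ∧ E₁) ≥ κ P(F₁) P(E₁)`, `F₁ = {s↔a, s↮b}`, `E₁ = {c↔s} ∪ {c↔b}`;
                          P3_κ : the same with `E = P(c ↔ {s,a,b})`; the 3-point row (C_λ) is the case `a = s`)

therefore holds for `G` as soon as it holds for the two smaller graphs `G ∖ e`, `G / e` AND the segment
`r ↦ (N, F, E)(r)` does not leave the (non-convex) region `{N ≥ κFE}`.  This file kernel-checks three sufficient
"concavity" criteria, each an exact identity plus a sign condition on endpoint data only: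

* `interp_product`   (form 1): `(F₁-F₀)(E₁-E₀) ≥ 0`   — identity
    `N(r) - κF(r)E(r) = (1-r)(N₀-κF₀E₀) + r(N₁-κF₁E₁) + κ r(1-r)(F₁-F₀)(E₁-E₀)`;
* `interp_condF`     (form 2): `F₀, F₁ > 0` and `(N₁F₀ - N₀F₁)(F₁-F₀) ≥ 0` (the conditional probability `N/F` moves in the
    same direction as `F`) — identity `N(r)/F(r) = (1-r)N₀/F₀ + rN₁/F₁ + r(1-r)(F₁-F₀)(N₁F₀-N₀F₁)/(F(r)F₀F₁)`;
* `interp_condE`     (form 3): `E₀, E₁ > 0` and `(N₁E₀ - N₀E₁)(E₁-E₀) ≥ 0` (same with the roles of `F`, `E` exchanged).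

For TCB'_κ / P3_κ the probabilistic reading is: form 1 ⟺ `Cov(ω_e, 1_{F₁})·Cov(ω_e, 1_{E₁}) ≥ 0`; form 2 ⟺
`Cov_{μ(·|F₁)}(ω_e, 1_{E₁})·Cov(ω_e, 1_{F₁}) ≥ 0`; form 3 ⟺ `Cov_{μ(·|E₁)}(ω_e, 1_{F₁})·Cov(ω_e,1_{E₁}) ≥ 0`
(`E₁` is increasing, so `Cov(ω_e, 1_{E₁}) ≥ 0` always).  Examples (paper level, exact): the pair `e = {s,a}` always satisfies
form 1 (`P(F₁)` is non-decreasing in `w_{sa}`), and `G/sa` is the glued 3-point case where TCB'_{2/3} IS the lane's theorem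
(C½); pairs inside `{s,b}` (resp. inside `{s,a,b}` for P3) have `E₀ = E₁`, so the row for `G` is EQUIVALENT to the row for
`G ∖ e`.  CONJECTURE E* (lead gen 126; 0 failures in ≈ 100 adversarial searches on ≤ 7 vertices, exact rechecks): every
finite weighted graph has a pair satisfying one of the three criteria (for TCB'); E* ⟹ TCB'_{2/3} ⟹ TCB_{4/3} ⟹ TCB ⟹
TT-CHORD(E₃) on all graphs (with `…IncStarTwoSidedClusterBoundOneSided`, `…IncStarTwoSidedClusterBound`).  Form 1 alone
does NOT suffice (hub family `s–x_i–{a,b}`, `i ≤ 3`, weights `.99/.99/.3`: every pair has `Cov(ω_e,1_{F₁}) < 0`).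
-/

namespace Summit.CriticalPhenomena.PercolationContinuityZ3.Theorems

namespace IncStar

/-- **Product-form interpolation identity.**  For affine `N, F, E` on `[0,1]`:
`N(r) - κF(r)E(r) = (1-r)(N₀ - κF₀E₀) + r(N₁ - κF₁E₁) + κ·r(1-r)(F₁-F₀)(E₁-E₀)`. [this work] -/
theorem interp_product_identity (κ r N0 N1 F0 F1 E0 E1 : ℝ) :
    ((1 - r) * N0 + r * N1) - κ * ((1 - r) * F0 + r * F1) * ((1 - r) * E0 + r * E1)
      = (1 - r) * (N0 - κ * F0 * E0) + r * (N1 - κ * F1 * E1) + κ * (r * (1 - r)) * ((F1 - F0) * (E1 - E0)) := by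
  ring

/-- **Form 1 (product form).**  If `N ≥ κFE` holds at both endpoints, `κ ≥ 0`, and `F`, `E` move in the same direction
along the pair (`(F₁-F₀)(E₁-E₀) ≥ 0`), then `N(r) ≥ κF(r)E(r)` for every `r ∈ [0,1]`. [this work] -/
theorem interp_product (κ r N0 N1 F0 F1 E0 E1 : ℝ) (hκ : 0 ≤ κ) (hr0 : 0 ≤ r) (hr1 : r ≤ 1)
    (h0 : κ * F0 * E0 ≤ N0) (h1 : κ * F1 * E1 ≤ N1) (hmono : 0 ≤ (F1 - F0) * (E1 - E0)) :
    κ * ((1 - r) * F0 + r * F1) * ((1 - r) * E0 + r * E1) ≤ (1 - r) * N0 + r * N1 := by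
  have hid := interp_product_identity κ r N0 N1 F0 F1 E0 E1
  have h1r : 0 ≤ 1 - r := by linarith
  have t1 : 0 ≤ (1 - r) * (N0 - κ * F0 * E0) := mul_nonneg h1r (by linarith)
  have t2 : 0 ≤ r * (N1 - κ * F1 * E1) := mul_nonneg hr0 (by linarith)
  have t3 : 0 ≤ κ * (r * (1 - r)) * ((F1 - F0) * (E1 - E0)) :=
    mul_nonneg (mul_nonneg hκ (mul_nonneg hr0 h1r)) hmono
  linarith

/-- **Conditional-form interpolation identity.**  For affine `N, F` with `F₀, F₁ ≠ 0` and `F(r) ≠ 0`: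
`N(r)·F₀·F₁ - F(r)·((1-r)N₀F₁ + rN₁F₀) = r(1-r)(F₁-F₀)(N₁F₀ - N₀F₁)`, i.e.
`N(r)/F(r) = (1-r)N₀/F₀ + rN₁/F₁ + r(1-r)(F₁-F₀)(N₁F₀-N₀F₁)/(F(r)F₀F₁)`. [this work] -/
theorem interp_cond_identity (r N0 N1 F0 F1 : ℝ) :
    ((1 - r) * N0 + r * N1) * F0 * F1 - ((1 - r) * F0 + r * F1) * ((1 - r) * N0 * F1 + r * N1 * F0)
      = (r * (1 - r)) * ((F1 - F0) * (N1 * F0 - N0 * F1)) := by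
  ring

/-- **Form 2 (condition on `F`).**  If `N ≥ κFE` holds at both endpoints, `F₀, F₁ > 0`, and the conditional ratio `N/F`
moves in the same direction as `F` along the pair (`(N₁F₀ - N₀F₁)(F₁ - F₀) ≥ 0`), then `N(r) ≥ κF(r)E(r)` on `[0,1]`.
(For TCB'_κ: `N/F = P(E₁ | F₁)`; the hypothesis says `Cov_{μ(·|F₁)}(ω_e, 1_{E₁})` and `Cov(ω_e, 1_{F₁})` do not have
strictly opposite signs.) [this work] -/
theorem interp_condF (κ r N0 N1 F0 F1 E0 E1 : ℝ) (hr0 : 0 ≤ r) (hr1 : r ≤ 1)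
    (hF0 : 0 < F0) (hF1 : 0 < F1)
    (h0 : κ * F0 * E0 ≤ N0) (h1 : κ * F1 * E1 ≤ N1) (hW : 0 ≤ (N1 * F0 - N0 * F1) * (F1 - F0)) :
    κ * ((1 - r) * F0 + r * F1) * ((1 - r) * E0 + r * E1) ≤ (1 - r) * N0 + r * N1 := by
  have h1r : 0 ≤ 1 - r := by linarith
  -- F(r) > 0
  have hFr : 0 < (1 - r) * F0 + r * F1 := by
    rcases lt_or_ge r 1 with hr | hr
    · have : 0 < (1 - r) * F0 := mul_pos (by linarith) hF0
      have : 0 ≤ r * F1 := mul_nonneg hr0 (le_of_lt hF1)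
      linarith
    · have hr' : r = 1 := le_antisymm hr1 hr
      subst hr'; simp; exact hF1
  -- endpoint inequalities in ratio form, multiplied through: κ E0 F0 F1 ≤ N0 F1 etc.
  have e0 : κ * E0 * (F0 * F1) ≤ N0 * F1 := by nlinarith
  have e1 : κ * E1 * (F0 * F1) ≤ N1 * F0 := by nlinarith
  -- main: N(r) F0 F1 = F(r) [(1-r) N0 F1 + r N1 F0] + r(1-r)(F1-F0) W  ≥ F(r) κ E(r) F0 F1
  have hid := interp_cond_identity r N0 N1 F0 F1
  have key : κ * ((1 - r) * E0 + r * E1) * (F0 * F1) ≤ (1 - r) * N0 * F1 + r * N1 * F0 := by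
    have := add_le_add (mul_le_mul_of_nonneg_left e0 h1r) (mul_le_mul_of_nonneg_left e1 hr0)
    nlinarith
  have hW' : 0 ≤ (r * (1 - r)) * ((F1 - F0) * (N1 * F0 - N0 * F1)) := by
    have : 0 ≤ (F1 - F0) * (N1 * F0 - N0 * F1) := by nlinarith
    exact mul_nonneg (mul_nonneg hr0 h1r) this
  -- N(r) F0 F1 ≥ F(r) * key-lhs
  have step : ((1 - r) * F0 + r * F1) * (κ * ((1 - r) * E0 + r * E1) * (F0 * F1))
      ≤ ((1 - r) * N0 + r * N1) * F0 * F1 := by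
    have := mul_le_mul_of_nonneg_left key (le_of_lt hFr)
    nlinarith
  -- divide by F0 F1 > 0
  have hF01 : 0 < F0 * F1 := mul_pos hF0 hF1
  nlinarith

/-- **Form 3 (condition on `E`).**  If `N ≥ κFE` holds at both endpoints, `E₀, E₁ > 0`, and the conditional ratio `N/E`
moves in the same direction as `E` along the pair (`(N₁E₀ - N₀E₁)(E₁ - E₀) ≥ 0`), then `N(r) ≥ κF(r)E(r)` on `[0,1]`.
(For TCB'_κ: `N/E = P(F₁ | E₁)` and `E₁` is increasing, so the hypothesis reads `Cov_{μ(·|E₁)}(ω_e, 1_{F₁}) ≥ 0`.)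
[this work] -/
theorem interp_condE (κ r N0 N1 F0 F1 E0 E1 : ℝ) (hr0 : 0 ≤ r) (hr1 : r ≤ 1)
    (hE0 : 0 < E0) (hE1 : 0 < E1)
    (h0 : κ * F0 * E0 ≤ N0) (h1 : κ * F1 * E1 ≤ N1) (hW : 0 ≤ (N1 * E0 - N0 * E1) * (E1 - E0)) :
    κ * ((1 - r) * F0 + r * F1) * ((1 - r) * E0 + r * E1) ≤ (1 - r) * N0 + r * N1 := by
  have h := interp_condF κ r N0 N1 E0 E1 F0 F1 hr0 hr1 hE0 hE1
    (by linarith [mul_comm F0 E0]) (by linarith [mul_comm F1 E1]) hW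
  have hcomm : κ * ((1 - r) * E0 + r * E1) * ((1 - r) * F0 + r * F1)
      = κ * ((1 - r) * F0 + r * F1) * ((1 - r) * E0 + r * E1) := by ring
  linarith [hcomm]

/-- **Ratio form (monotone case).**  If `F, E > 0` at the endpoints and the ratio `ρ = N/(FE)` at the parameter `r`
dominates its value at one endpoint where `ρ ≥ κ` (here: `N(r)·F₀·E₀ ≥ N₀·F(r)·E(r)` and `N₀ ≥ κF₀E₀`), then
`N(r) ≥ κF(r)E(r)`.  (Trivial bookkeeping for the case "`ρ` has no interior minimum along the pair".) [this work] -/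
theorem interp_ratio_left (κ r N0 N1 F0 F1 E0 E1 : ℝ) (hF0 : 0 < F0) (hE0 : 0 < E0)
    (hFr : 0 ≤ (1 - r) * F0 + r * F1) (hEr : 0 ≤ (1 - r) * E0 + r * E1)
    (h0 : κ * F0 * E0 ≤ N0)
    (hρ : N0 * (((1 - r) * F0 + r * F1) * ((1 - r) * E0 + r * E1)) ≤ ((1 - r) * N0 + r * N1) * (F0 * E0)) :
    κ * ((1 - r) * F0 + r * F1) * ((1 - r) * E0 + r * E1) ≤ (1 - r) * N0 + r * N1 := by
  have hFE0 : 0 < F0 * E0 := mul_pos hF0 hE0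
  have hFEr : 0 ≤ ((1 - r) * F0 + r * F1) * ((1 - r) * E0 + r * E1) := mul_nonneg hFr hEr
  -- κ F(r)E(r) · F0E0 ≤ N0 · F(r)E(r) ≤ N(r) F0 E0
  have s1 : κ * (((1 - r) * F0 + r * F1) * ((1 - r) * E0 + r * E1)) * (F0 * E0)
      ≤ N0 * (((1 - r) * F0 + r * F1) * ((1 - r) * E0 + r * E1)) := by
    have := mul_le_mul_of_nonneg_left h0 hFEr
    nlinarith
  nlinarith

end IncStar

end Summit.CriticalPhenomena.PercolationContinuityZ3.Theorems
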